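import Literature.AnabelianGeometry.EtaleTheta.DivisorMonoidsCuspidalWeak
import Literature.AnabelianGeometry.EtaleTheta.Discharge.Sec3RealifiedCuspidalWeak
import HarnessLib

/-!
# [EtTh] Def. 3.1 (i) / 3.6 (iii): the non-cuspidal and cuspidal prime sets of `Φ₀(Y)` are DISJOINT —
# `hdisj` discharged for the weak-vocabulary data `ofRlfZWeak` / `ofRlfRWeak`

Mochizuki, *The étale theta function …*, Publ. RIMS **45** (2009), Def. 3.1 (i) p.70 (a prime log-divisor
is a special-fibre component or a cusp), Def. 3.6 (iii) p.77 ("an element of `Φ(A)` is non-cuspidal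
(respectively, cuspidal) if it arises … from a non-cuspidal (respectively, cuspidal) log-divisor")
[cite: MochizukiEtTh2009, Def 3.6 p.77].

WEAK-VOCABULARY TWIN of the `Φ₀`/`ofRlfZ` half of abc-iut-L2-d2's `Sec3Cor38iiiOfRlf.lean` (p416187;
its tempered-Frobenioid half and the Cor. 3.8 (iii) assembly over `ofRlfZWeak` stay with abc-iut-L2-d2):
for abc-iut-L6-t12's `ofRlfZWeak dm hpf` over abc-iut-L2-t3's `treeMonoidVocabWeak` with
`hpf : ∀ Y, IsPerfFactorialCof (Φ₀ Y)` — the repaired hypothesis that, unlike the printed Prop. 3.4 (i),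
holds at `Ÿ`, `Z_∞` (cell findings F-L2d2-1 / F-L2d2-2):
* `DivisorMonoids.disjoint_supp_of_mem_ncsp₀_of_mem_csp₀_weak` — for WEAKLY perf-factorial `Φ₀(Y)` the
  images of a non-cuspidal and of a cuspidal log-divisor have disjoint supports (from abc-iut-L2-d2's weak
  `Φ₀`-lemma `IsPerfFactorialWeak.exists_isPrimary_precsim_of_factorMap_ne_one`, `DivisorMonoidsCuspidalWeak.lean`);
* hence `RealifiedDivisorMonoids.ofRlfZWeak_disjoint_toRSuppOf` (the input `hdisj` of
  `ofRlfZWeak_ncspR_inf_cspR_eq_bot`, DISCHARGED) and `ofRlfZWeak_ncspR_inf_cspR` /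
  `ofRlfRWeak_ncspR_inf_cspR`: `Φ₀^ℝ(Y)^ncsp ⊓ Φ₀^ℝ(Y)^csp = 1`, unconditionally.
Theorems only; no new definitions.  Seat abc-iut-L6-t12 (cell abc-iut; F-L2d2-1 / F-L2d2-2 repair chain,
piece (H₀)).  HONEST FRAMING: nothing here asserts the data exist for an actual curve; nothing here bears on
[IUTchIII] Cor. 3.12.
-/

namespace Literature.AnabelianGeometry.EtaleTheta

open CategoryTheory Opposite Literature.AlgebraicGeometry.Frobenioids

universe u₀ v₀ w

/-! ### `Φ₀`-level: non-cuspidal and cuspidal log-divisors have disjoint supports (weak `Φ₀(Y)`) -/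

namespace DivisorMonoids

variable {D₀ : Type u₀} [Category.{v₀} D₀] (T : DivisorMonoids.{u₀, v₀, w} D₀) (Y : D₀ᵒᵖ)

/-- **Def. 3.1 (i): a prime log-divisor is either a special-fibre component or a cusp** — for WEAKLY
perf-factorial `Φ₀(Y)`, the images in `Φ₀(Y)^rlf_factor` of a non-cuspidal `a` and a cuspidal `c` have
disjoint supports: a prime in both supports contains primaries `m ≼ a`, `m' ≼ c` with `m ≼ m'`, so `m` is
non-cuspidal and cuspidal, i.e. `m = 0`. [cite: MochizukiEtTh2009, Def 3.1 p.70] -/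
theorem disjoint_supp_of_mem_ncsp₀_of_mem_csp₀_weak (hpf : IsPerfFactorialWeak (T.Φ₀.obj Y))
    {a c : T.Φ₀.obj Y} (ha : a ∈ T.ncsp₀ Y) (hc : c ∈ T.csp₀ Y) :
    Disjoint (supp (factorMap _ (Perfection.of _ a))) (supp (factorMap _ (Perfection.of _ c))) := by
  have hS : IsSharp (T.Φ₀.obj Y) := hpf.isDivisorial.isSharp
  refine Set.disjoint_left.2 fun 𝔮 h𝔮a h𝔮c => ?_
  obtain ⟨m, hm, hm𝔮, hma⟩ := hpf.exists_isPrimary_precsim_of_factorMap_ne_one h𝔮a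
  obtain ⟨m', -, hm'𝔮, hm'c⟩ := hpf.exists_isPrimary_precsim_of_factorMap_ne_one h𝔮c
  have hmm' : Precsim m m' := Perfection.of_precsim_of_iff.1 (Primes.precsim_of_mem_carrier 𝔮 hm𝔮 hm'𝔮)
  exact hm.1 (T.eq_one_of_mem_ncsp₀_of_mem_csp₀ Y (T.mem_ncsp₀_of_precsim Y hS hma ha)
    (T.mem_csp₀_of_precsim Y hS (hmm'.trans hm'c) hc))

end DivisorMonoids

/-! ### The realified data `ofRlfZWeak`: the non-cuspidal and cuspidal prime sets are disjoint -/

namespace RealifiedDivisorMonoids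

variable {D₀ : Type u₀} [Category.{v₀} D₀] (dm : DivisorMonoids.{u₀, v₀, w} D₀)
  (hpf : ∀ Y : D₀ᵒᵖ, IsPerfFactorialCof (dm.Φ₀.obj Y))

/-- For `ofRlfZWeak dm hpf` the sets of non-cuspidal and of cuspidal primes of `Φ₀(Y)` are disjoint (the
input `hdisj` of `ofRlfZWeak_ncspR_inf_cspR_eq_bot`, DISCHARGED). [cite: MochizukiEtTh2009, Def 3.6 p.77] -/
theorem ofRlfZWeak_disjoint_toRSuppOf (Y : D₀ᵒᵖ) :
    Disjoint (toRSuppOfWeak dm hpf Y (dm.ncsp₀ Y)) (toRSuppOfWeak dm hpf Y (dm.csp₀ Y)) :=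
  (disjoint_toRSuppOfWeak_iff dm hpf Y _ _).2 fun _ ha _ hc =>
    dm.disjoint_supp_of_mem_ncsp₀_of_mem_csp₀_weak Y (hpf Y).weak ha hc

/-- Hence `Φ₀^ℝ(Y)^ncsp ⊓ Φ₀^ℝ(Y)^csp = 1` for `ofRlfZWeak`, unconditionally. [cite: MochizukiEtTh2009, Def 3.6 p.77] -/
theorem ofRlfZWeak_ncspR_inf_cspR (Y : D₀ᵒᵖ) :
    (ofRlfZWeak dm hpf).ncspR Y ⊓ (ofRlfZWeak dm hpf).cspR Y = ⊥ :=
  ofRlfZWeak_ncspR_inf_cspR_eq_bot dm hpf Y (ofRlfZWeak_disjoint_toRSuppOf dm hpf Y)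

/-- The same for `ofRlfRWeak` (same (non-)cuspidal parts). [cite: MochizukiEtTh2009, Def 3.6 p.77] -/
theorem ofRlfRWeak_ncspR_inf_cspR (Y : D₀ᵒᵖ) :
    (ofRlfRWeak dm hpf).ncspR Y ⊓ (ofRlfRWeak dm hpf).cspR Y = ⊥ :=
  ofRlfZWeak_ncspR_inf_cspR dm hpf Y

end RealifiedDivisorMonoids


end Literature.AnabelianGeometry.EtaleTheta
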